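import Mathlib.Analysis.SpecialFunctions.Pow.Real
import HarnessLib

/-!
# The reverse-Harris rows `P3_λ` are stable under parallel composition at `{s,a,b,c}` for every `λ ≥ 8/5`, modulo the 3-point face inequality `(C½)` — and `8/5` is sharp

Support file for crux `stmt-CriticalPhenomena-4575` (`NoHeavyLowerTail`), seat `prim-l12-p1` gen 31 (`--supports stmt-CriticalPhenomena-4575`;
memo `run/shared/lean/prim/prim-l12/FROM-prim-l12-p1-g31-P3-SHARP-ROW-STABILITY.md`, §7).  No definitions, no sorries, standard axioms.
Companion of `…SuperTerminalP3HalfStable` (lead g134, THEOREM C: `λ = 2` modulo the tropical law `(T)`; `(T)`-only stability holds exactly for `λ ≥ 2`) and of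
`…SuperTerminalP3TermEdges` (this seat: single terminal–terminal edges, `λ ≥ 4/3`).

Setting (cells as in `…SuperTerminalQuarticOrdered`).  A 4-terminal piece has partition-law cells `n = P(s|a|b|c)`, `σ = P(sa|b|c)`, `ζ = P(sa|bc)`, `τ = P(sac|b)`, `β = P(bc|s|a)`,
`ξs = P(sc|a|b)`, `ξa = P(ac|s|b)`, `γ = P(c singleton)`; `g = ζ+τ`, `S = ζ+τ+β+ξs+ξa`, `m = n+σ`.  The row `P3_λ : μ(F)·μ(c↔T) ≤ λ·μ(F ∩ c↔T)` (`F = {s↔a}∩{s↮b}`, `T = {s,a,b}`)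
reads `(σ+g)(1−γ) ≤ λ g`.  The FACE INEQUALITY of the piece with `s, a` identified, at the port `c` — `(C½)`: `3·μ(S↔b↔c) ≤ (1+2μ(S↔b))·μ(c↔{S,b})`, a THEOREM for every finite
weighted graph (`ThreePointIsoSexticUniversal.faceHalf_all`, equivalently the 3-point row `P3_{3/2}`) — reads in the cells of the 4-point piece `(m+S)(1−γ) ≤ (3/2)·S`, i.e.
`2(n+σ+S)(1−γ) ≤ 3S`.  Composite cells by the join rule (`PartitionLatticeGluing.real_partLE`): `Q = (n+σ)(n'+σ') − nn'`, `A = (n+σ+β+ζ)(n'+σ'+β'+ζ') − (n+β)(n'+β')`,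
`B = (n+σ+ξs+ξa+τ)(…)' − (n+ξs)(n'+ξs') − (n+ξa)(n'+ξa') + nn'`, `γ∘ = γγ'`, `μ(F∘) = A+B−Q`, `μ(F∘ ∩ c↔T) = A+B−2Q`.

MAIN THEOREM (`p3lam_stable`): **for every `λ ≥ 8/5`: `[P3_λ ∧ (C½ of ·/sa)](piece 1) ∧ [P3_λ ∧ (C½ of ·/sa)](piece 2) ⟹ P3_λ(composite)`**; hence (graph level, by the
join rule and `faceHalf_all`) for every `λ ≥ 8/5` the row `P3_λ` — in particular `5·μ(F)μ(c↔T) ≤ 8·μ(F ∩ c↔T)` — holds on all finite weighted graphs iff it holds on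
`{s,a,b,c}`-prime graphs.  This improves THEOREM C's range `λ ≥ 2` to `λ ≥ 8/5`; the conjectured sharp constant of the row is `3/2`.
SHARPNESS (`p3lam_stable_sharp`): at `λ = 159/100 < 8/5` two abstract pieces satisfying all hypotheses (and the realizability side conditions `n+σ ≤ γ`, `S+γ ≤ 1`) have a composite
violating `P3_λ`; the memo shows such pairs exist for every `λ < 8/5`, and that NO set of catalogued laws restores stability at `λ = 3/2`.
PROOF.  With `c = λ−1`, `x = γ`, `y = γ'`: the row gives `g ≥ σ(1−x)/(c+x)`, the face inequality gives `S ≥ 2m(1−x)/(1+2x)`; the composite has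
`μ(F∘ ∩ c↔T) ≥ σS' + σ'S + ng' + n'g`, and comparing the coefficients of `σn'`, `nσ'`, `σσ'` reduces everything to `coeff`:
`(1−xy)(1+2y)(c+x) ≤ (c+xy)(2(1−y)(c+x) + (1−x)(1+2y))`, whose slack is `(1−y)·[2c² + (c−1)x − 2xy(1−x)] ≥ (1−y)·[2(x − (3−c)/4)² + 3(5c−3)(c+1)/8]` — nonnegative exactly when
`c ≥ 3/5`, i.e. `λ ≥ 8/5`.
-/

namespace Summit.CriticalPhenomena.PercolationContinuityZ3.Theorems.SuperTerminalP3LamStable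

/-- The coefficient inequality (coefficient of `σn'`): for `c ≥ 3/5`, `x, y ∈ [0,1]`:
`(1−xy)(1+2y)(c+x) ≤ (c+xy)(2(1−y)(c+x) + (1−x)(1+2y))`; slack `= (1−y)(2c² + (c−1)x − 2xy(1−x))`. [this work] -/
theorem coeff {c x y : ℝ} (hc : 3 / 5 ≤ c) (hx0 : 0 ≤ x) (hx1 : x ≤ 1) (hy1 : y ≤ 1) :
    (1 - x * y) * (1 + 2 * y) * (c + x) ≤ (c + x * y) * (2 * (1 - y) * (c + x) + (1 - x) * (1 + 2 * y)) := by
  have e : (c + x * y) * (2 * (1 - y) * (c + x) + (1 - x) * (1 + 2 * y)) - (1 - x * y) * (1 + 2 * y) * (c + x) =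
      (1 - y) * (2 * c ^ 2 + (c - 1) * x - 2 * x * y * (1 - x)) := by ring
  have hG : 0 ≤ 2 * c ^ 2 + (c - 1) * x - 2 * x * y * (1 - x) := by
    have h1 : 2 * x * y * (1 - x) ≤ 2 * x * (1 - x) := by
      have : 0 ≤ 2 * x * (1 - x) := by nlinarith
      nlinarith
    -- 2c² + (c−3)x + 2x² = 2(x − (3−c)/4)² + 3(5c−3)(c+1)/8
    nlinarith [sq_nonneg (x - (3 - c) / 4)]
  have h2 : 0 ≤ (1 - y) * (2 * c ^ 2 + (c - 1) * x - 2 * x * y * (1 - x)) := mul_nonneg (by linarith) hG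
  linarith

/-- `ρ_λ ≤ θ`: for `c ≥ 1/2`, `x ∈ [0,1]`: `(1−x)(1+2x) ≤ 2(1−x)(c+x)`. [this work] -/
theorem rho_le_theta {c x : ℝ} (hc : 1 / 2 ≤ c) (hx1 : x ≤ 1) : (1 - x) * (1 + 2 * x) ≤ 2 * (1 - x) * (c + x) := by
  have e : 2 * (1 - x) * (c + x) - (1 - x) * (1 + 2 * x) = (1 - x) * (2 * c - 1) := by ring
  have h : 0 ≤ (1 - x) * (2 * c - 1) := mul_nonneg (by linarith) (by linarith)
  linarith

/-- **The reduced inequality.**  `c ≥ 3/5`; per piece `n, σ ≥ 0`, reals `g, S`, `x ∈ [0,1]` with the row `σ(1−x) ≤ g(c+x)` and the face bound `2(n+σ)(1−x) ≤ S(1+2x)`;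
then `(σσ' + σn' + nσ')(1 − xy) ≤ (c + xy)(σS' + σ'S + ng' + n'g)`. [this work] -/
theorem core {c n σ g S x n' σ' g' S' y : ℝ} (hc : 3 / 5 ≤ c)
    (hn : 0 ≤ n) (hσ : 0 ≤ σ) (hx0 : 0 ≤ x) (hx1 : x ≤ 1) (hP : σ * (1 - x) ≤ g * (c + x)) (hF : 2 * (n + σ) * (1 - x) ≤ S * (1 + 2 * x))
    (hn' : 0 ≤ n') (hσ' : 0 ≤ σ') (hy0 : 0 ≤ y) (hy1 : y ≤ 1) (hP' : σ' * (1 - y) ≤ g' * (c + y)) (hF' : 2 * (n' + σ') * (1 - y) ≤ S' * (1 + 2 * y)) :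
    (σ * σ' + σ * n' + n * σ') * (1 - x * y) ≤ (c + x * y) * (σ * S' + σ' * S + n * g' + n' * g) := by
  have hc0 : 0 < c := by linarith
  have hcx : 0 < c + x := by linarith
  have hcy : 0 < c + y := by linarith
  have h2x : 0 < 1 + 2 * x := by linarith
  have h2y : 0 < 1 + 2 * y := by linarith
  have hcxy : 0 ≤ c + x * y := by nlinarith
  -- coefficient inequalities
  have Ci := coeff hc hx0 hx1 hy1                           -- σ n'
  have Ciii := coeff hc hy0 hy1 hx1                         -- n σ'  (x ↔ y)
  have Rx := rho_le_theta (show (1:ℝ) / 2 ≤ c by linarith) hx1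
  -- everything multiplied by D = (1+2x)(1+2y)(c+x)(c+y) > 0
  have key : (σ * σ' + σ * n' + n * σ') * (1 - x * y) * ((1 + 2 * x) * (1 + 2 * y) * (c + x) * (c + y)) ≤
      (c + x * y) * (σ * S' + σ' * S + n * g' + n' * g) * ((1 + 2 * x) * (1 + 2 * y) * (c + x) * (c + y)) := by
    -- the four lower bounds times their (nonnegative) cofactors
    have t1 := mul_le_mul_of_nonneg_left hF' (show 0 ≤ σ * ((1 + 2 * x) * (c + x) * (c + y)) * (c + x * y) by positivity)
    have t2 := mul_le_mul_of_nonneg_left hF (show 0 ≤ σ' * ((1 + 2 * y) * (c + x) * (c + y)) * (c + x * y) by positivity)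
    have t3 := mul_le_mul_of_nonneg_left hP' (show 0 ≤ n * ((1 + 2 * x) * (1 + 2 * y) * (c + x)) * (c + x * y) by positivity)
    have t4 := mul_le_mul_of_nonneg_left hP (show 0 ≤ n' * ((1 + 2 * x) * (1 + 2 * y) * (c + y)) * (c + x * y) by positivity)
    -- coefficient inequalities times nonnegative cell products
    have c1 := mul_le_mul_of_nonneg_left Ci (show 0 ≤ σ * n' * ((1 + 2 * x) * (c + y)) by positivity)
    have c3 := mul_le_mul_of_nonneg_left Ciii (show 0 ≤ n * σ' * ((1 + 2 * y) * (c + x)) by positivity)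
    -- σσ': use (i) with the roles (x,y) and ρ(x) ≤ θ(x):  (c+xy)[θ(y)+θ(x)] ≥ (c+xy)[θ(y)+ρ(x)] ≥ 1−xy
    have c2a := mul_le_mul_of_nonneg_left Ci (show 0 ≤ σ * σ' * ((1 + 2 * x) * (c + y)) by positivity)
    have c2b := mul_le_mul_of_nonneg_left Rx (show 0 ≤ σ * σ' * ((1 + 2 * y) * (c + y)) * (c + x * y) by positivity)
    linarith only [t1, t2, t3, t4, c1, c3, c2a, c2b]
  have hD : 0 < (1 + 2 * x) * (1 + 2 * y) * (c + x) * (c + y) := by positivity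
  exact le_of_mul_le_mul_right key hD

/-- **MAIN THEOREM: for `λ ≥ 8/5` the row `P3_λ` is stable under parallel composition at `{s,a,b,c}` modulo the face inequality `(C½)` of the `s–a`-glued pieces.**
Piece 1 (cells unprimed) and piece 2 (primed): cells `≥ 0`, `γ, γ' ≤ 1`, the row `(σ+ζ+τ)(1−γ) ≤ λ(ζ+τ)` and the face inequality of the piece with `s,a` identified (port `c`)
`2(n+σ+ζ+τ+β+ξs+ξa)(1−γ) ≤ 3(ζ+τ+β+ξs+ξa)` (a theorem for every finite weighted graph, `faceHalf_all`).  Then the composite brackets `Q, A, B` (as in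
`SuperTerminalP3HalfStable.p3half_stable`) satisfy `(A + B − Q)(1 − γγ') ≤ λ(A + B − 2Q)`.  For `λ ≥ 8/5`, `P3_λ` on all finite weighted graphs thus reduces to
`{s,a,b,c}`-prime graphs. [this work] -/
theorem p3lam_stable {lam n σ ζ β ξs ξa τ γ n' σ' ζ' β' ξs' ξa' τ' γ' : ℝ} (hlam : 8 / 5 ≤ lam)
    (hn : 0 ≤ n) (hσ : 0 ≤ σ) (hζ : 0 ≤ ζ) (hβ : 0 ≤ β) (hξs : 0 ≤ ξs) (hξa : 0 ≤ ξa) (hτ : 0 ≤ τ) (hγ : 0 ≤ γ) (hγ1 : γ ≤ 1)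
    (hn' : 0 ≤ n') (hσ' : 0 ≤ σ') (hζ' : 0 ≤ ζ') (hβ' : 0 ≤ β') (hξs' : 0 ≤ ξs') (hξa' : 0 ≤ ξa') (hτ' : 0 ≤ τ') (hγ' : 0 ≤ γ') (hγ1' : γ' ≤ 1)
    (hP : (σ + ζ + τ) * (1 - γ) ≤ lam * (ζ + τ))
    (hF : 2 * (n + σ + ζ + τ + β + ξs + ξa) * (1 - γ) ≤ 3 * (ζ + τ + β + ξs + ξa))
    (hP' : (σ' + ζ' + τ') * (1 - γ') ≤ lam * (ζ' + τ'))
    (hF' : 2 * (n' + σ' + ζ' + τ' + β' + ξs' + ξa') * (1 - γ') ≤ 3 * (ζ' + τ' + β' + ξs' + ξa')) :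
    (((n + σ + β + ζ) * (n' + σ' + β' + ζ') - (n + β) * (n' + β')) +
      ((n + σ + ξs + ξa + τ) * (n' + σ' + ξs' + ξa' + τ') - (n + ξs) * (n' + ξs') - (n + ξa) * (n' + ξa') + n * n') -
      ((n + σ) * (n' + σ') - n * n')) * (1 - γ * γ') ≤
    lam * (((n + σ + β + ζ) * (n' + σ' + β' + ζ') - (n + β) * (n' + β')) +
      ((n + σ + ξs + ξa + τ) * (n' + σ' + ξs' + ξa' + τ') - (n + ξs) * (n' + ξs') - (n + ξa) * (n' + ξa') + n * n') -
      2 * ((n + σ) * (n' + σ') - n * n')) := by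
  set Qc := (n + σ) * (n' + σ') - n * n' with hQc
  set Ac := (n + σ + β + ζ) * (n' + σ' + β' + ζ') - (n + β) * (n' + β') with hAc
  set Bc := (n + σ + ξs + ξa + τ) * (n' + σ' + ξs' + ξa' + τ') - (n + ξs) * (n' + ξs') - (n + ξa) * (n' + ξa') + n * n' with hBc
  have eQ : Qc = σ * σ' + σ * n' + n * σ' := by rw [hQc]; ring
  have eAB : Ac + Bc - 2 * Qc =
      (σ * ((β' + ζ') + (ξs' + ξa' + τ')) + σ' * ((β + ζ) + (ξs + ξa + τ)) + n * (ζ' + τ') + n' * (ζ + τ)) +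
      (ζ * ζ' + ζ * β' + β * ζ' + τ * τ' + τ * (ξs' + ξa') + (ξs + ξa) * τ' + ξs * ξa' + ξa * ξs') := by
    rw [hAc, hBc, hQc]; ring
  have hX : 0 ≤ ζ * ζ' + ζ * β' + β * ζ' + τ * τ' + τ * (ξs' + ξa') + (ξs + ξa) * τ' + ξs * ξa' + ξa * ξs' := by positivity
  have hgg : 0 ≤ γ * γ' := mul_nonneg hγ hγ'
  -- the claim as `Qc(1−γγ') ≤ (Ac + Bc − 2Qc)(lam − 1 + γγ')`
  suffices H : Qc * (1 - γ * γ') ≤ ((lam - 1) + γ * γ') * (Ac + Bc - 2 * Qc) by nlinarith only [H]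
  -- reduced hypotheses with c = lam − 1
  have hPr : σ * (1 - γ) ≤ (ζ + τ) * ((lam - 1) + γ) := by nlinarith only [hP]
  have hPr' : σ' * (1 - γ') ≤ (ζ' + τ') * ((lam - 1) + γ') := by nlinarith only [hP']
  have hFr : 2 * (n + σ) * (1 - γ) ≤ ((β + ζ) + (ξs + ξa + τ)) * (1 + 2 * γ) := by nlinarith only [hF]
  have hFr' : 2 * (n' + σ') * (1 - γ') ≤ ((β' + ζ') + (ξs' + ξa' + τ')) * (1 + 2 * γ') := by nlinarith only [hF']
  have C := core (c := lam - 1) (by linarith) hn hσ hγ hγ1 hPr hFr hn' hσ' hγ' hγ1' hPr' hFr'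
  have hc1 : 0 ≤ (lam - 1) + γ * γ' := by nlinarith only [hlam, hgg]
  have hmid : ((lam - 1) + γ * γ') * (σ * ((β' + ζ') + (ξs' + ξa' + τ')) + σ' * ((β + ζ) + (ξs + ξa + τ)) + n * (ζ' + τ') + n' * (ζ + τ))
      ≤ ((lam - 1) + γ * γ') * (Ac + Bc - 2 * Qc) :=
    mul_le_mul_of_nonneg_left (by rw [eAB]; linarith only [hX]) hc1
  rw [eQ]
  have eQ2 : (Ac + Bc - 2 * (σ * σ' + σ * n' + n * σ')) = Ac + Bc - 2 * Qc := by rw [eQ]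
  rw [eQ2]
  linarith only [C, hmid]

/-- **Sharpness of `8/5`.**  At `λ = 159/100` the hypotheses of `p3lam_stable` do NOT imply the conclusion: piece 1 = `σ = 1/10`, `τ = 1/30`, `β = 1/100`, `γ = 241/400`
(`n = ζ = ξs = ξa = 0`; row tight, face inequality strict, `n+σ ≤ γ`, total mass `≤ 1`), piece 2 = `n' = 49/50`, `β' = 33/2500`, `γ' = 9801/10000` (face inequality strict)
give a composite with `(A+B−Q)(1−γγ') > λ(A+B−2Q)`.  Such pairs exist for every `λ < 8/5` (memo §7: first-order expansion at a row-tight piece with `γ = 3/4 − (λ−1)/4`). [this work] -/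
theorem p3lam_stable_sharp : ∃ lam n σ ζ β ξs ξa τ γ n' σ' ζ' β' ξs' ξa' τ' γ' : ℝ,
    3 / 2 < lam ∧ lam < 8 / 5 ∧
    0 ≤ n ∧ 0 ≤ σ ∧ 0 ≤ ζ ∧ 0 ≤ β ∧ 0 ≤ ξs ∧ 0 ≤ ξa ∧ 0 ≤ τ ∧ 0 ≤ γ ∧ γ ≤ 1 ∧ n + σ ≤ γ ∧ ζ + τ + β + ξs + ξa + γ ≤ 1 ∧
    0 ≤ n' ∧ 0 ≤ σ' ∧ 0 ≤ ζ' ∧ 0 ≤ β' ∧ 0 ≤ ξs' ∧ 0 ≤ ξa' ∧ 0 ≤ τ' ∧ 0 ≤ γ' ∧ γ' ≤ 1 ∧ n' + σ' ≤ γ' ∧ ζ' + τ' + β' + ξs' + ξa' + γ' ≤ 1 ∧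
    (σ + ζ + τ) * (1 - γ) ≤ lam * (ζ + τ) ∧ 2 * (n + σ + ζ + τ + β + ξs + ξa) * (1 - γ) ≤ 3 * (ζ + τ + β + ξs + ξa) ∧
    (σ' + ζ' + τ') * (1 - γ') ≤ lam * (ζ' + τ') ∧ 2 * (n' + σ' + ζ' + τ' + β' + ξs' + ξa') * (1 - γ') ≤ 3 * (ζ' + τ' + β' + ξs' + ξa') ∧
    lam * (((n + σ + β + ζ) * (n' + σ' + β' + ζ') - (n + β) * (n' + β')) +
      ((n + σ + ξs + ξa + τ) * (n' + σ' + ξs' + ξa' + τ') - (n + ξs) * (n' + ξs') - (n + ξa) * (n' + ξa') + n * n') -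
      2 * ((n + σ) * (n' + σ') - n * n')) <
    (((n + σ + β + ζ) * (n' + σ' + β' + ζ') - (n + β) * (n' + β')) +
      ((n + σ + ξs + ξa + τ) * (n' + σ' + ξs' + ξa' + τ') - (n + ξs) * (n' + ξs') - (n + ξa) * (n' + ξa') + n * n') -
      ((n + σ) * (n' + σ') - n * n')) * (1 - γ * γ') := by
  refine ⟨159 / 100, 0, 1 / 10, 0, 1 / 100, 0, 0, 1 / 30, 241 / 400, 49 / 50, 0, 0, 33 / 2500, 0, 0, 0, 9801 / 10000, ?_⟩
  norm_num

end Summit.CriticalPhenomena.PercolationContinuityZ3.Theorems.SuperTerminalP3LamStable
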